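import Literature.NumberTheory.PAdicHodge.DeRhamFilteredComparison
import Literature.NumberTheory.PAdicHodge.CupLogInjectiveDeRham
import Literature.NumberTheory.PAdicHodge.HodgeTateUnramifiedWeights
import Literature.NumberTheory.PAdicHodge.BdRCyclotomic
import Literature.NumberTheory.PAdicHodge.DualExpElliptic
import Literature.NumberTheory.EllipticCurves.FrobeniusTateModuleProofs
import Literature.NumberTheory.EllipticCurves.TateModuleFinrankProofs
import Literature.NumberTheory.GaloisRepresentations.LocalKroneckerWeberInertiaProofs
import Literature.NumberTheory.GaloisRepresentations.PeriodRingDataInnerTwist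
import Mathlib.RingTheory.TensorProduct.Free
import HarnessLib

/-!
# The Néron de Rham datum of an elliptic curve EXISTS once `V_pE` is de Rham:
# `dim_F D⁰_dR(V) = 1` for every two-dimensional de Rham `V` with `det V = ℚ_p(1)`

Topic `Literature/NumberTheory/PAdicHodge`; namespaces `Literature.NumberTheory.GaloisRepresentations.PeriodRingData`
(abstract layer) and `Literature.NumberTheory.PAdicHodge` (the genuine `B_dR(F)`). THEOREMS ONLY (no definition, no
named fact, no instance, no `sorry`).

The tree's construction statement `nonempty_neronDeRhamDatum` (file `NeronDeRhamDatum`, cite-only: Kato, LNM 1553,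
Ch. II Ex. 1.3.5 « `V_pA` is a de Rham representation, `Lie(A)` is identified with `D_dR(V_pA)/D⁰_dR(V_pA)` » —
for an elliptic curve `dim D_dR = 2`, `dim Lie = 1`, so `dim D⁰_dR = 1`) is here REDUCED to the single de Rham
input `isDeRham_restrictedRationalTateRep` / `IsDeRham (rationalTateRep W p)` (Fontaine 1982), by the following
argument, which uses only the Weil pairing through `det ρ_{E,p} = χ_cyclo` (tree theorem
`WeierstrassCurve.det_galoisRepTate_eq_cyclotomicCharacter_holds`, Silverman *AEC* III.8.1/III.8.3) and Wach's
adapted basis (tree `exists_basis_mem_filTensor_iff_of_isDeRham`):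

Let `V` be a two-dimensional de Rham representation of `Γ_F` with `det V = χ` (the `p`-adic cyclotomic character)
and let `(𝒷₀, 𝒷₁)` be a `B_dR`-basis of `B_dR ⊗ V` made of vectors of `D_dR(V)`, adapted to the filtration with
weights `w₀, w₁` (`Fil^n(B_dR ⊗ V) = ⊕_k Fil^{n − w_k} B_dR · 𝒷_k`). The determinant `g ∈ B_dR` of the coordinates
of `(𝒷₀, 𝒷₁)` along a `ℚ_p`-basis of `V` satisfies `σ(g) · χ(σ) = g` (invariance of the `𝒷_k`, `det ρ = χ`), hence
`g · t ∈ B_dR^{Γ_F} = F` (`σ t = χ(σ) t`), i.e. **`g = f · t⁻¹`, `f ∈ Fˣ`**. Reading the filtration degree of `g`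
in the two bases — `g ∈ Fil^{w₀ + w₁}` (the `𝒷_k` lie in `Fil^{w_k}`) and `g⁻¹ ∈ Fil^{−w₀−w₁}` (the vectors
`1 ⊗ v_j` lie in `Fil⁰`) — against `t⁻¹ ∈ Fil^i ↔ i ≤ −1` gives **`w₀ + w₁ = −1`**: exactly one weight is `≥ 0`,
and `D⁰_dR(V) = Fil⁰ ∩ D_dR(V)` is the `F`-line spanned by the corresponding `𝒷_k` (coordinates of invariant
vectors are invariant, `repr_tensorRep_of_mem_D`, and `F ∩ Fil¹ B_dR = 0`).

* §1 `PeriodRingData.nonempty_filZeroLine_of_adaptedBasis_of_weights` — abstract: an adapted invariant basis with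
  exactly one weight `≥ 0` (all others `≤ −1`) yields a generator of `Fil⁰ D`.
* §2 `PeriodRingData.weight_add_weight_eq_neg_one` — abstract: the determinant argument above, for any period-ring
  datum carrying an element `t` with `σ t = χ(σ) t`, `t · t' = 1`, `t' ∈ Fil^i ↔ i ≤ −1`.
* §3 `PAdicHodge.nonempty_filZeroLine_of_isDeRham_of_det` — for `B_dR(F)`: every two-dimensional de Rham `ρ` with
  `det ρ = χ` has `Nonempty (FilZeroLine ρ)` (equivalently `dim_F Fil⁰ D_dR(ρ) = 1`,
  `finrank_filD_zero_eq_one_of_isDeRham_of_det`).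
* §4 elliptic curves: `nonempty_neronDeRhamDatum_of_isDeRham` (`W/F`, from `IsDeRham (rationalTateRep W p)`),
  `nonempty_filZeroLine_restrictedRationalTateRep_of_isDeRham` (`W/K₀ ⊆ F`, from the cite-only
  `isDeRham_restrictedRationalTateRep` VERBATIM), and the reduction of the named fact
  `nonempty_neronDeRhamDatum_of_forall_isDeRham : (∀ F p hp W, IsDeRham (rationalTateRep W p)) → nonempty_neronDeRhamDatum`.

BSD is not proved by any of this; `isDeRham_restrictedRationalTateRep` stays a cite-only input.

## References
* K. Kato, LNM 1553 (1993), Ch. II Ex. 1.3.5 (`V_pA` de Rham, `Lie(A) = D_dR/D⁰_dR`). [Kato1993LNM1553]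
* J.-M. Fontaine, Astérisque 223 (1994), Exp. II §1.5.5 (`σ t = χ(σ) t`, `Fil^i B_dR = t^i B_dR⁺`), Exp. III §1.5
  (admissibility, `D_B`). [FontaineAsterisque223III]
* N. Wach, Bull. SMF 124 (1996), §B.2.3 (adapted bases). [Wach1996]
* J. H. Silverman, *AEC* (2009), Prop. III.8.1, III.8.3 (`∧² T_ℓ E ≅ ℤ_ℓ(1)`). [SilvermanAEC2009]
-/

noncomputable section

open scoped TensorProduct
open TensorProduct

/-! ## §1–§2 Abstract layer: adapted bases of rank two and the determinant argument -/

namespace Literature.NumberTheory.GaloisRepresentations.PeriodRingData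

-- Mathlib's own global value; needed for instance problems on `𝔅.B ⊗[P] M` (see `PAdicHodgeProofs`).
set_option maxSynthPendingDepth 3

universe u v v' w w'

variable {Γ : Type u} [Group Γ] [TopologicalSpace Γ] {P : Type v} {E : Type v'} [Field P]
  [TopologicalSpace P] [Field E] [Algebra P E]
  {M : Type w'} [AddCommGroup M] [Module P M] [TopologicalSpace M]
  (𝔅 : PeriodRingData.{u, v, v', w} Γ P E) (ρ : ContinuousRep Γ P M)

/-! ### §1 A generator of `Fil⁰ D` from an adapted invariant basis with one non-negative weight -/

/-- **The coordinates of an invariant vector along an invariant basis are scalars of `E = B^Γ`.**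
[cite: FontaineAsterisque223III, Exp. III §1.5.1 and Thm. 1.5.2] -/
theorem exists_repr_eq_algebraMap_of_mem_D {ι : Type*} [Fintype ι]
    (𝒷 : Module.Basis ι 𝔅.B (𝔅.B ⊗[P] M)) (h𝒷D : ∀ k, 𝒷 k ∈ 𝔅.D ρ) {x : 𝔅.B ⊗[P] M}
    (hx : x ∈ 𝔅.D ρ) (k : ι) : ∃ e : E, 𝒷.repr x k = algebraMap E 𝔅.B e := by
  have hinv : ∀ σ : Γ, σ • 𝒷.repr x k = 𝒷.repr x k := fun σ => by
    rw [← 𝔅.repr_tensorRep_of_mem_D ρ 𝒷 h𝒷D σ x k, (𝔅.mem_D_iff ρ x).1 hx σ]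
  have hmem : 𝒷.repr x k ∈ {b : 𝔅.B | ∀ σ : Γ, σ • b = b} := hinv
  rw [𝔅.invariants_eq] at hmem
  obtain ⟨e, he⟩ := hmem
  exact ⟨e, he.symm⟩

/-- **A generator of `Fil⁰ D_B(V)` from an adapted invariant basis with exactly one weight `≥ 0`.** Let
`(𝒷_k)` be a `B`-basis of `B ⊗ V` made of vectors of `D_B(V)`, with weights `w_k` such that
`x ∈ Fil^n(B ⊗ V) ↔ ∀ k, coordₖ(x) ∈ Fil^{n − w_k} B` (Wach's adapted basis), and suppose `0 ≤ w_{k₀}` while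
`w_k ≤ −1` for every other `k`. Then `𝒷_{k₀}` generates `Fil⁰ D_B(V)` (so `FilZeroLine` is inhabited): an invariant
`x ∈ Fil⁰` has invariant coordinates `e_k ∈ E` with `e_k ∈ Fil^{−w_k} ⊆ Fil¹`, hence `e_k = 0`, for `k ≠ k₀`
(`E ∩ Fil¹ = 0`). [cite: Wach1996, §B.2.3, proof of Prop. 2 (p. 394)] [cite: FontaineAsterisque223III, Exp. III §1.5.4] -/
theorem nonempty_filZeroLine_of_adaptedBasis_of_weights {ι : Type*} [Fintype ι] [DecidableEq ι]
    (𝒷 : Module.Basis ι 𝔅.B (𝔅.B ⊗[P] M)) (h𝒷D : ∀ k, 𝒷 k ∈ 𝔅.D ρ) (w : ι → ℤ)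
    (h𝒷w : ∀ k, 𝒷 k ∈ 𝔅.filTensor M (w k))
    (hiff : ∀ (n : ℤ) (x : 𝔅.B ⊗[P] M), x ∈ 𝔅.filTensor M n ↔ ∀ k, 𝒷.repr x k ∈ 𝔅.fil (n - w k))
    (k₀ : ι) (hk₀ : 0 ≤ w k₀) (hneg : ∀ k, k ≠ k₀ → w k ≤ -1) :
    ∃ d : 𝔅.FilZeroLine ρ, d.ω = 𝒷 k₀ := by
  refine ⟨⟨𝒷 k₀, h𝒷D k₀, PAdicHodge.TateGraded.filTensor_antitone 𝔅 hk₀ (h𝒷w k₀), 𝒷.ne_zero k₀, ?_⟩, rfl⟩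
  intro x hxD hx0
  have hcoord := (hiff 0 x).1 hx0
  choose e he using fun k => 𝔅.exists_repr_eq_algebraMap_of_mem_D ρ 𝒷 h𝒷D hxD k
  have hzero : ∀ k, k ≠ k₀ → 𝒷.repr x k = 0 := by
    intro k hk
    have h1 : algebraMap E 𝔅.B (e k) ∈ 𝔅.fil 1 := by
      have h := hcoord k
      rw [he k] at h
      exact 𝔅.fil_antitone (by have := hneg k hk; omega) h
    rw [he k, PAdicHodge.TateGraded.eq_zero_of_algebraMap_mem_fil_one 𝔅 h1, map_zero]
  refine ⟨e k₀, ?_⟩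
  calc x = ∑ k, 𝒷.repr x k • 𝒷 k := (𝒷.sum_repr x).symm
    _ = 𝒷.repr x k₀ • 𝒷 k₀ := by
      rw [Finset.sum_eq_single k₀ (fun k _ hk => by rw [hzero k hk, zero_smul])
        (fun h => absurd (Finset.mem_univ k₀) h)]
    _ = e k₀ • 𝒷 k₀ := by rw [he k₀, algebraMap_smul]

/-! ### §2 The determinant argument: `w₀ + w₁ = −1` -/

section Det

variable {𝔅 ρ}

omit [TopologicalSpace Γ] [TopologicalSpace P] [TopologicalSpace M] in
/-- Expansion along a `P`-basis `v` of `V`: `x = Σ_j coordⱼ(x) ⊗ v_j` for the `B`-basis `(1 ⊗ v_j)` of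
`B ⊗_P V`. [folklore] -/
private theorem eq_sum_repr_tmul {ι : Type*} [Fintype ι] (v : Module.Basis ι P M) (x : 𝔅.B ⊗[P] M) :
    x = ∑ j, (Algebra.TensorProduct.basis 𝔅.B v).repr x j ⊗ₜ[P] v j := by
  conv_lhs => rw [← (Algebra.TensorProduct.basis 𝔅.B v).sum_repr x]
  refine Finset.sum_congr rfl fun j _ => ?_
  rw [Algebra.TensorProduct.basis_apply, smul_tmul', smul_eq_mul, mul_one]

omit [TopologicalSpace Γ] [TopologicalSpace P] [TopologicalSpace M] in
/-- Coordinates of `Σ_j f_j ⊗ v_j` along `(1 ⊗ v_j)`. [folklore] -/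
private theorem basis_repr_sum_tmul {ι : Type*} [Fintype ι] (v : Module.Basis ι P M) (f : ι → 𝔅.B) (i : ι) :
    (Algebra.TensorProduct.basis 𝔅.B v).repr (∑ j, f j ⊗ₜ[P] v j) i = f i := by
  have h : ∑ j, f j ⊗ₜ[P] v j = ∑ j, f j • Algebra.TensorProduct.basis 𝔅.B v j :=
    Finset.sum_congr rfl fun j _ => by
      rw [Algebra.TensorProduct.basis_apply, smul_tmul', smul_eq_mul, mul_one]
  rw [h, (Algebra.TensorProduct.basis 𝔅.B v).repr_sum_self]

/-- **The diagonal action in coordinates**: along the basis `(1 ⊗ v_j)`,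
`coordᵢ(σ x) = Σ_j (v-matrix of ρ(σ))ᵢⱼ · σ(coordⱼ x)`. [cite: FontaineAsterisque223III, Exp. III §1.3] -/
theorem basis_repr_tensorRep {ι : Type*} [Fintype ι] [DecidableEq ι] (v : Module.Basis ι P M)
    (σ : Γ) (x : 𝔅.B ⊗[P] M) (i : ι) :
    (Algebra.TensorProduct.basis 𝔅.B v).repr (𝔅.tensorRep ρ σ x) i =
      ∑ j, algebraMap P 𝔅.B (LinearMap.toMatrix v v (ρ σ) i j) *
        (σ • (Algebra.TensorProduct.basis 𝔅.B v).repr x j) := by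
  -- `σ x = Σ_j σ(c_j) ⊗ ρ(σ) v_j = Σ_i (Σ_j R_{ij} σ(c_j)) ⊗ v_i`
  have h1 : ∀ j, 𝔅.tensorRep ρ σ ((Algebra.TensorProduct.basis 𝔅.B v).repr x j ⊗ₜ[P] v j) =
      ∑ i, (algebraMap P 𝔅.B (LinearMap.toMatrix v v (ρ σ) i j) *
        (σ • (Algebra.TensorProduct.basis 𝔅.B v).repr x j)) ⊗ₜ[P] v i := by
    intro j
    rw [tensorRep_apply_tmul]
    conv_lhs => rw [← v.sum_repr ((ρ σ) (v j)), tmul_sum]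
    refine Finset.sum_congr rfl fun i _ => ?_
    rw [LinearMap.toMatrix_apply]
    simp only [tmul_smul, smul_tmul', Algebra.smul_def]
  have hx : 𝔅.tensorRep ρ σ x = ∑ i, (∑ j, algebraMap P 𝔅.B (LinearMap.toMatrix v v (ρ σ) i j) *
      (σ • (Algebra.TensorProduct.basis 𝔅.B v).repr x j)) ⊗ₜ[P] v i :=
    calc 𝔅.tensorRep ρ σ x
        = 𝔅.tensorRep ρ σ (∑ j, (Algebra.TensorProduct.basis 𝔅.B v).repr x j ⊗ₜ[P] v j) := by
          rw [← eq_sum_repr_tmul v x]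
      _ = ∑ j, 𝔅.tensorRep ρ σ ((Algebra.TensorProduct.basis 𝔅.B v).repr x j ⊗ₜ[P] v j) := map_sum _ _ _
      _ = ∑ j, ∑ i, (algebraMap P 𝔅.B (LinearMap.toMatrix v v (ρ σ) i j) *
            (σ • (Algebra.TensorProduct.basis 𝔅.B v).repr x j)) ⊗ₜ[P] v i :=
          Finset.sum_congr rfl fun j _ => h1 j
      _ = ∑ i, ∑ j, (algebraMap P 𝔅.B (LinearMap.toMatrix v v (ρ σ) i j) *
            (σ • (Algebra.TensorProduct.basis 𝔅.B v).repr x j)) ⊗ₜ[P] v i := Finset.sum_comm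
      _ = ∑ i, (∑ j, algebraMap P 𝔅.B (LinearMap.toMatrix v v (ρ σ) i j) *
            (σ • (Algebra.TensorProduct.basis 𝔅.B v).repr x j)) ⊗ₜ[P] v i :=
          Finset.sum_congr rfl fun i _ => by rw [sum_tmul]
  rw [hx, basis_repr_sum_tmul]

variable (v : Module.Basis (Fin 2) P M)

/-- **Equivariance of the coordinate determinant**: `det(σ x, σ y) = det ρ(σ) · σ(det(x, y))`.
[cite: FontaineAsterisque223III, Exp. III §1.3] -/
theorem det2_tensorRep (σ : Γ) (x y : 𝔅.B ⊗[P] M) :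
    ((Algebra.TensorProduct.basis 𝔅.B v).repr (𝔅.tensorRep ρ σ x) 0 * (Algebra.TensorProduct.basis 𝔅.B v).repr (𝔅.tensorRep ρ σ y) 1 -
        (Algebra.TensorProduct.basis 𝔅.B v).repr (𝔅.tensorRep ρ σ x) 1 * (Algebra.TensorProduct.basis 𝔅.B v).repr (𝔅.tensorRep ρ σ y) 0) =
      algebraMap P 𝔅.B (LinearMap.det (ρ σ : M →ₗ[P] M)) *
        (σ • ((Algebra.TensorProduct.basis 𝔅.B v).repr x 0 * (Algebra.TensorProduct.basis 𝔅.B v).repr y 1 -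
        (Algebra.TensorProduct.basis 𝔅.B v).repr x 1 * (Algebra.TensorProduct.basis 𝔅.B v).repr y 0)) := by
  classical
  rw [← LinearMap.det_toMatrix v, Matrix.det_fin_two]
  simp only [basis_repr_tensorRep, Fin.sum_univ_two, smul_sub, smul_mul', map_sub, map_mul]
  ring

/-- For invariant `x, y`: `det(x, y) = det ρ(σ) · σ(det(x, y))`. [cite: FontaineAsterisque223III, Exp. III §1.5] -/
theorem det2_eq_of_mem_D {x y : 𝔅.B ⊗[P] M} (hx : x ∈ 𝔅.D ρ) (hy : y ∈ 𝔅.D ρ) (σ : Γ) :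
    ((Algebra.TensorProduct.basis 𝔅.B v).repr x 0 * (Algebra.TensorProduct.basis 𝔅.B v).repr y 1 -
        (Algebra.TensorProduct.basis 𝔅.B v).repr x 1 * (Algebra.TensorProduct.basis 𝔅.B v).repr y 0) =
      algebraMap P 𝔅.B (LinearMap.det (ρ σ : M →ₗ[P] M)) *
        (σ • ((Algebra.TensorProduct.basis 𝔅.B v).repr x 0 * (Algebra.TensorProduct.basis 𝔅.B v).repr y 1 -
        (Algebra.TensorProduct.basis 𝔅.B v).repr x 1 * (Algebra.TensorProduct.basis 𝔅.B v).repr y 0)) := by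
  conv_lhs => rw [← (𝔅.mem_D_iff ρ x).1 hx σ, ← (𝔅.mem_D_iff ρ y).1 hy σ]
  exact det2_tensorRep v σ x y

omit [TopologicalSpace Γ] [TopologicalSpace P] [TopologicalSpace M] in
/-- `det(x, y) ∈ Fil^{i+j}` when `x ∈ Fil^i(B ⊗ V)`, `y ∈ Fil^j(B ⊗ V)` (coordinates along `1 ⊗ v_j` detect the
filtration). [cite: FontaineAsterisque223III, Exp. III §1.5.4] -/
theorem det2_mem_fil {i j : ℤ} {x y : 𝔅.B ⊗[P] M} (hx : x ∈ 𝔅.filTensor M i) (hy : y ∈ 𝔅.filTensor M j) :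
    ((Algebra.TensorProduct.basis 𝔅.B v).repr x 0 * (Algebra.TensorProduct.basis 𝔅.B v).repr y 1 -
        (Algebra.TensorProduct.basis 𝔅.B v).repr x 1 * (Algebra.TensorProduct.basis 𝔅.B v).repr y 0) ∈ 𝔅.fil (i + j) := by
  classical
  have hxc : ∀ k, (Algebra.TensorProduct.basis 𝔅.B v).repr x k ∈ 𝔅.fil i := fun k =>
    𝔅.mem_fil_of_sum_tmul_mem_filTensor v (by rw [← eq_sum_repr_tmul v x]; exact hx) k
  have hyc : ∀ k, (Algebra.TensorProduct.basis 𝔅.B v).repr y k ∈ 𝔅.fil j := fun k =>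
    𝔅.mem_fil_of_sum_tmul_mem_filTensor v (by rw [← eq_sum_repr_tmul v y]; exact hy) k
  exact Submodule.sub_mem _ (𝔅.mul_mem_fil i j _ _ (hxc 0) (hyc 1)) (𝔅.mul_mem_fil i j _ _ (hxc 1) (hyc 0))

omit [TopologicalSpace Γ] [TopologicalSpace P] [TopologicalSpace M] in
/-- **Change of basis**: for a `B`-basis `(𝒷₀, 𝒷₁)` of `B ⊗ V`, the coordinate determinant `g = det(𝒷₀, 𝒷₁)` is
inverted by the determinant of the matrix `A_{jk} = coord_k^{𝒷}(1 ⊗ v_j)`: `det A · g = 1`. [folklore] -/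
private theorem detA_mul_det2_eq_one (𝒷 : Module.Basis (Fin 2) 𝔅.B (𝔅.B ⊗[P] M)) :
    (𝒷.repr (Algebra.TensorProduct.basis 𝔅.B v 0) 0 * 𝒷.repr (Algebra.TensorProduct.basis 𝔅.B v 1) 1 -
        𝒷.repr (Algebra.TensorProduct.basis 𝔅.B v 0) 1 * 𝒷.repr (Algebra.TensorProduct.basis 𝔅.B v 1) 0) *
      ((Algebra.TensorProduct.basis 𝔅.B v).repr (𝒷 0) 0 * (Algebra.TensorProduct.basis 𝔅.B v).repr (𝒷 1) 1 -
        (Algebra.TensorProduct.basis 𝔅.B v).repr (𝒷 0) 1 * (Algebra.TensorProduct.basis 𝔅.B v).repr (𝒷 1) 0) = 1 := by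
  set β := Algebra.TensorProduct.basis 𝔅.B v with hβ
  -- `Σ_k A_{jk} C_{ki} = δ_{ji}` with `C_{ki} = coord_i^{β}(𝒷_k)`
  have hrel : ∀ j i, 𝒷.repr (β j) 0 * β.repr (𝒷 0) i + 𝒷.repr (β j) 1 * β.repr (𝒷 1) i =
      if j = i then 1 else 0 := by
    intro j i
    have h := congrArg (fun z => β.repr z i) (𝒷.sum_repr (β j))
    simp only [Fin.sum_univ_two, map_add, map_smul, Finsupp.add_apply, Finsupp.smul_apply, smul_eq_mul,
      β.repr_self, Finsupp.single_apply] at h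
    rw [h]
  have h00 := hrel 0 0
  have h01 := hrel 0 1
  have h10 := hrel 1 0
  have h11 := hrel 1 1
  simp only [if_true, Fin.zero_eq_one_iff, OfNat.ofNat_ne_one, one_ne_zero, if_false] at h00 h01 h10 h11
  have key : (𝒷.repr (β 0) 0 * β.repr (𝒷 0) 0 + 𝒷.repr (β 0) 1 * β.repr (𝒷 1) 0) *
        (𝒷.repr (β 1) 0 * β.repr (𝒷 0) 1 + 𝒷.repr (β 1) 1 * β.repr (𝒷 1) 1) -
      (𝒷.repr (β 0) 0 * β.repr (𝒷 0) 1 + 𝒷.repr (β 0) 1 * β.repr (𝒷 1) 1) *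
        (𝒷.repr (β 1) 0 * β.repr (𝒷 0) 0 + 𝒷.repr (β 1) 1 * β.repr (𝒷 1) 0) = 1 * 1 - 0 * 0 := by
    rw [h00, h11, h01, h10]
  linear_combination key

variable (χ : Γ → P) (T T' : 𝔅.B)
  (hT : ∀ σ : Γ, σ • T = algebraMap P 𝔅.B (χ σ) * T) (hTT' : T * T' = 1)
  (hT' : ∀ i : ℤ, T' ∈ 𝔅.fil i ↔ i ≤ -1)
  (hdet : ∀ σ : Γ, LinearMap.det (ρ σ : M →ₗ[P] M) = χ σ)

include v hT hTT' hT' hdet in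
/-- **The weights of an adapted invariant basis of a rank-two representation of determinant `χ` add up to `−1`.**
Let `t ∈ B` satisfy `σ t = χ(σ) t`, `t t' = 1`, `t' ∈ Fil^i ↔ i ≤ −1` (for `B_dR`: `t = log[ε]`), and let
`det ρ = χ`. For a `B`-basis `(𝒷₀, 𝒷₁)` of `B ⊗ V` of invariant vectors with weights `w₀, w₁` in Wach's sense, the
coordinate determinant `g = det(𝒷₀, 𝒷₁)` satisfies `σ(g) χ(σ) = g`, so `g t ∈ B^Γ = E`, `g = f t'` (`f ∈ E`);
`g ∈ Fil^{w₀+w₁}` and `t' ∉ Fil⁰` force `w₀ + w₁ ≤ −1`, while `(det A) g = 1` with `det A ∈ Fil^{−w₀−w₁}` gives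
`t = (det A) f ∈ Fil^{−w₀−w₁}`, and `1 = t t' ∉ Fil¹` forces `−w₀ − w₁ ≤ 1`. Hence **`w₀ + w₁ = −1`**.
[cite: FontaineAsterisque223III, Exp. II §1.5.5 and Exp. III §1.5] [cite: Wach1996, §B.2.3, proof of Prop. 2 (p. 394)] -/
theorem weight_add_weight_eq_neg_one (𝒷 : Module.Basis (Fin 2) 𝔅.B (𝔅.B ⊗[P] M))
    (h𝒷D : ∀ k, 𝒷 k ∈ 𝔅.D ρ) (w : Fin 2 → ℤ) (h𝒷w : ∀ k, 𝒷 k ∈ 𝔅.filTensor M (w k))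
    (hiff : ∀ (n : ℤ) (x : 𝔅.B ⊗[P] M), x ∈ 𝔅.filTensor M n ↔ ∀ k, 𝒷.repr x k ∈ 𝔅.fil (n - w k)) :
    w 0 + w 1 = -1 := by
  classical
  set β := Algebra.TensorProduct.basis 𝔅.B v with hβ
  set g := ((Algebra.TensorProduct.basis 𝔅.B v).repr (𝒷 0) 0 * (Algebra.TensorProduct.basis 𝔅.B v).repr (𝒷 1) 1 -
        (Algebra.TensorProduct.basis 𝔅.B v).repr (𝒷 0) 1 * (Algebra.TensorProduct.basis 𝔅.B v).repr (𝒷 1) 0) with hg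
  set dA := 𝒷.repr (β 0) 0 * 𝒷.repr (β 1) 1 - 𝒷.repr (β 0) 1 * 𝒷.repr (β 1) 0 with hdA
  have hAg : dA * g = 1 := detA_mul_det2_eq_one v 𝒷
  -- (1) `σ g = χ(σ)⁻¹ g`, so `g T` is invariant
  have hgT : ∀ σ : Γ, σ • (g * T) = g * T := by
    intro σ
    have h1 := det2_eq_of_mem_D v (h𝒷D 0) (h𝒷D 1) σ
    rw [hdet σ, ← hg] at h1
    rw [smul_mul', hT σ]
    calc (σ • g) * (algebraMap P 𝔅.B (χ σ) * T) = (algebraMap P 𝔅.B (χ σ) * (σ • g)) * T := by ring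
      _ = g * T := by rw [← h1]
  have hmem : g * T ∈ {b : 𝔅.B | ∀ σ : Γ, σ • b = b} := hgT
  rw [𝔅.invariants_eq] at hmem
  obtain ⟨f, hf⟩ := hmem
  -- `g = f T'`
  have hgf : g = algebraMap E 𝔅.B f * T' := by
    rw [hf, mul_assoc, hTT', mul_one]
  -- (2) `g ∈ Fil^{w₀ + w₁}`; `T' ∉ Fil⁰` ⇒ `w₀ + w₁ ≤ −1`
  have hgfil : g ∈ 𝔅.fil (w 0 + w 1) := det2_mem_fil v (h𝒷w 0) (h𝒷w 1)
  have hf0 : f ≠ 0 := by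
    rintro rfl
    rw [map_zero, zero_mul] at hgf
    rw [hgf, mul_zero] at hAg
    exact zero_ne_one hAg
  have hle : w 0 + w 1 ≤ -1 := by
    by_contra hlt
    have hg0 : g ∈ 𝔅.fil 0 := 𝔅.fil_antitone (by omega) hgfil
    have hT'0 : T' ∈ 𝔅.fil 0 := by
      have h1 : algebraMap E 𝔅.B f⁻¹ * g ∈ 𝔅.fil (0 + 0) :=
        𝔅.mul_mem_fil 0 0 _ _ (PAdicHodge.TateGraded.algebraMap_mem_fil_zero 𝔅 _) hg0
      rw [hgf, ← mul_assoc, ← map_mul, inv_mul_cancel₀ hf0, map_one, one_mul, add_zero] at h1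
      exact h1
    have := (hT' 0).1 hT'0
    omega
  -- (3) `det A ∈ Fil^{−w₀−w₁}` and `T = det A · f` ⇒ `T ∈ Fil^{−w₀−w₁}` ⇒ `1 = T T' ∈ Fil^{−w₀−w₁−1}` ⇒ `−w₀−w₁ ≤ 1`
  have hA : ∀ j k, 𝒷.repr (β j) k ∈ 𝔅.fil (0 - w k) := fun j k =>
    (hiff 0 (β j)).1 (by
      rw [hβ, Algebra.TensorProduct.basis_apply]
      exact one_tmul_mem_filTensor_zero (v j)) k
  have hdAfil : dA ∈ 𝔅.fil (-w 0 - w 1) := by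
    have h1 : 𝒷.repr (β 0) 0 * 𝒷.repr (β 1) 1 ∈ 𝔅.fil ((0 - w 0) + (0 - w 1)) :=
      𝔅.mul_mem_fil _ _ _ _ (hA 0 0) (hA 1 1)
    have h2 : 𝒷.repr (β 0) 1 * 𝒷.repr (β 1) 0 ∈ 𝔅.fil ((0 - w 1) + (0 - w 0)) :=
      𝔅.mul_mem_fil _ _ _ _ (hA 0 1) (hA 1 0)
    have e1 : (0 - w 0) + (0 - w 1) = -w 0 - w 1 := by ring
    have e2 : (0 - w 1) + (0 - w 0) = -w 0 - w 1 := by ring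
    rw [e1] at h1
    rw [e2] at h2
    exact Submodule.sub_mem _ h1 h2
  have hTeq : T = dA * algebraMap E 𝔅.B f := by
    have h1 : dA * (algebraMap E 𝔅.B f * T') * T = T := by rw [← hgf, hAg, one_mul]
    calc T = dA * (algebraMap E 𝔅.B f * T') * T := h1.symm
      _ = dA * algebraMap E 𝔅.B f * (T * T') := by ring
      _ = dA * algebraMap E 𝔅.B f := by rw [hTT', mul_one]
  have hTfil : T ∈ 𝔅.fil (-w 0 - w 1) := by
    have h1 : dA * algebraMap E 𝔅.B f ∈ 𝔅.fil ((-w 0 - w 1) + 0) :=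
      𝔅.mul_mem_fil _ _ _ _ hdAfil (PAdicHodge.TateGraded.algebraMap_mem_fil_zero 𝔅 _)
    rw [add_zero] at h1
    rwa [hTeq]
  have hge : -w 0 - w 1 ≤ 1 := by
    by_contra hlt
    have h1 : (1 : 𝔅.B) ∈ 𝔅.fil ((-w 0 - w 1) + (-1)) := by
      rw [← hTT']
      exact 𝔅.mul_mem_fil _ _ _ _ hTfil ((hT' (-1)).2 le_rfl)
    have h2 : algebraMap E 𝔅.B 1 ∈ 𝔅.fil 1 := by
      rw [map_one]
      exact 𝔅.fil_antitone (by omega) h1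
    exact one_ne_zero (PAdicHodge.TateGraded.eq_zero_of_algebraMap_mem_fil_one 𝔅 h2)
  omega

include v hT hTT' hT' hdet in
/-- **A generator of `Fil⁰ D_B(V)` exists for a rank-two admissible `V` with `det V = χ`**, given an adapted
invariant basis (`weight_add_weight_eq_neg_one`: exactly one weight is `≥ 0`; then `FilZeroLine.ofAdaptedBasis`).
[cite: Kato1993LNM1553, Ch. II Ex. 1.3.5] [cite: Wach1996, §B.2.3, proof of Prop. 2 (p. 394)] -/
theorem nonempty_filZeroLine_of_adaptedBasis (𝒷 : Module.Basis (Fin 2) 𝔅.B (𝔅.B ⊗[P] M))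
    (h𝒷D : ∀ k, 𝒷 k ∈ 𝔅.D ρ) (w : Fin 2 → ℤ) (h𝒷w : ∀ k, 𝒷 k ∈ 𝔅.filTensor M (w k))
    (hiff : ∀ (n : ℤ) (x : 𝔅.B ⊗[P] M), x ∈ 𝔅.filTensor M n ↔ ∀ k, 𝒷.repr x k ∈ 𝔅.fil (n - w k)) :
    Nonempty (𝔅.FilZeroLine ρ) := by
  classical
  have hsum := weight_add_weight_eq_neg_one v χ T T' hT hTT' hT' hdet 𝒷 h𝒷D w h𝒷w hiff
  rcases le_or_gt 0 (w 0) with h0 | h0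
  · obtain ⟨d, -⟩ := 𝔅.nonempty_filZeroLine_of_adaptedBasis_of_weights ρ 𝒷 h𝒷D w h𝒷w hiff 0 h0 fun k hk => by
      rw [Fin.eq_one_of_ne_zero k hk]
      omega
    exact ⟨d⟩
  · obtain ⟨d, -⟩ := 𝔅.nonempty_filZeroLine_of_adaptedBasis_of_weights ρ 𝒷 h𝒷D w h𝒷w hiff 1 (by omega)
      fun k hk => by
        have hk0 : k = 0 := by
          by_contra h
          exact hk (Fin.eq_one_of_ne_zero k h)
        rw [hk0]
        omega
    exact ⟨d⟩

end Det

end Literature.NumberTheory.GaloisRepresentations.PeriodRingData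

/-! ## §3 The genuine datum `B_dR(F)`: two-dimensional de Rham representations of determinant `χ_cyclo` -/

namespace Literature.NumberTheory.PAdicHodge

open Field ValuativeRel
open Literature.NumberTheory.GaloisRepresentations
open Literature.NumberTheory.GaloisRepresentations.IsNonarchimedeanLocalField

-- Mathlib's own global value; needed for instance problems on `𝔅.B ⊗[P] M` (see `PAdicHodgeProofs`).
set_option maxSynthPendingDepth 3

variable {F : Type} [Field F] [ValuativeRel F] [TopologicalSpace F] [IsNonarchimedeanLocalField F]
  [CharZero F] {p : ℕ} [Fact p.Prime] [Fact (¬ IsUnit (p : integerC F))]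
  [IsAdicComplete (Ideal.span {(p : integerC F)}) (integerC F)]
  (hp : valuation F p < 1)

/-- **`σ(t) = χ(σ) t` in the datum `bdRPeriodRingData hp`**, the scalar `χ(σ) ∈ ℚ_p` entering through the datum's
`ℚ_p → F → B_dR` (any `ℚ_p`-algebra structure on `F` is the canonical one, `LocalField.ringHom_padic_ext`).
[cite: FontaineAsterisque223III, Exp. II §1.5.5] -/
theorem smul_tFrac_bdRPeriodRingData [Algebra ℚ_[p] F] (σ : absoluteGaloisGroup F) :
    σ • (show (bdRPeriodRingData (F := F) (p := p) hp).B from (tFrac : FracBdR F p)) =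
      algebraMap ℚ_[p] (bdRPeriodRingData (F := F) (p := p) hp).B
          (((GaloisRep.cyclotomicCharacter F p σ : ℤ_[p]ˣ) : ℤ_[p]) : ℚ_[p]) *
        (show (bdRPeriodRingData (F := F) (p := p) hp).B from (tFrac : FracBdR F p)) := by
  have halg : ∀ c : ℚ_[p], algebraMap ℚ_[p] F c = LocalField.padicRingHom F p hp c := fun c =>
    RingHom.congr_fun (LocalField.ringHom_padic_ext (algebraMap ℚ_[p] F) (LocalField.padicRingHom F p hp)) c
  rw [PeriodRingData.algebraMap_eq, algebraMap_bdRPeriodRingData (surjective_fontaineTheta_integerC hp) hp,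
    embBdRHom_algebraMap_padic hp (surjective_fontaineTheta_integerC hp) halg]
  exact smul_tFrac σ

/-- **Every two-dimensional de Rham representation of `Γ_F` with determinant the cyclotomic character has a
generator of `D⁰_dR = Fil⁰ D_dR`** (for the tree's `bdRPeriodRingData hp`, any `ℚ_p`-algebra structure on `F`):
Wach's adapted basis (`exists_basis_mem_filTensor_iff_of_isDeRham`) has rank `2 = dim_{ℚ_p} V` and its weights add
up to `−1` (`weight_add_weight_eq_neg_one` with `t = log[ε]`: `smul_tFrac`, `tFrac_inv_mem_fil_iff`).
[cite: Kato1993LNM1553, Ch. II Ex. 1.3.5] [cite: FontaineAsterisque223III, Exp. II §1.5.5 and Exp. III §1.5]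
[cite: Wach1996, §B.2.3, proof of Prop. 2 (p. 394)] -/
theorem nonempty_filZeroLine_of_isDeRham_of_det [Algebra ℚ_[p] F]
    {M : Type} [AddCommGroup M] [Module ℚ_[p] M] [TopologicalSpace M] [Module.Finite ℚ_[p] M]
    (ρ : GaloisRep F ℚ_[p] M) (h2 : Module.finrank ℚ_[p] M = 2)
    (hρ : GaloisRep.IsDeRham (bdRPeriodRingData (F := F) (p := p) hp) ρ)
    (hdet : ∀ σ : absoluteGaloisGroup F, LinearMap.det (ρ σ : M →ₗ[ℚ_[p]] M) =
      (((GaloisRep.cyclotomicCharacter F p σ : ℤ_[p]ˣ) : ℤ_[p]) : ℚ_[p])) :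
    Nonempty ((bdRPeriodRingData (F := F) (p := p) hp).FilZeroLine ρ) := by
  classical
  have hF := surjective_fontaineTheta_integerC (F := F) (p := p) hp
  haveI : IsDomain (BDeRhamPlus (integerC F) p) := isDomain_bDeRhamPlus hF
  obtain ⟨d, 𝒷, w, h𝒷D, h𝒷w, hiff⟩ := exists_basis_mem_filTensor_iff_of_isDeRham hp ρ hρ
  -- the adapted basis has `d = 2` elements
  have hd : d = 2 := by
    have h := Module.finrank_eq_card_basis 𝒷
    rw [Module.finrank_baseChange, h2, Fintype.card_fin] at h
    exact h.symm
  subst hd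
  let v : Module.Basis (Fin 2) ℚ_[p] M := Module.finBasisOfFinrankEq ℚ_[p] M h2
  refine PeriodRingData.nonempty_filZeroLine_of_adaptedBasis (𝔅 := bdRPeriodRingData (F := F) (p := p) hp)
    (ρ := ρ) v (fun σ => (((GaloisRep.cyclotomicCharacter F p σ : ℤ_[p]ˣ) : ℤ_[p]) : ℚ_[p]))
    (show (bdRPeriodRingData (F := F) (p := p) hp).B from (tFrac : FracBdR F p))
    (show (bdRPeriodRingData (F := F) (p := p) hp).B from ((tFrac : FracBdR F p)⁻¹ : FracBdR F p))
    (smul_tFrac_bdRPeriodRingData hp) ?_ (fun i => tFrac_inv_mem_fil_iff hF hp i) hdet 𝒷 h𝒷D w h𝒷w hiff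
  exact mul_inv_cancel₀ (tFrac_ne_zero hF)

/-- **`dim_F D⁰_dR(V) = 1`** for a two-dimensional de Rham `V` with `det V = χ_cyclo` (the dimension form of
`nonempty_filZeroLine_of_isDeRham_of_det`, by `FilZeroLine.nonempty_filZeroLine_iff`).
[cite: Kato1993LNM1553, Ch. II Ex. 1.3.5] [cite: Wach1996, §B.2.3, proof of Prop. 2 (p. 394)] -/
theorem finrank_filD_zero_eq_one_of_isDeRham_of_det [Algebra ℚ_[p] F]
    {M : Type} [AddCommGroup M] [Module ℚ_[p] M] [TopologicalSpace M] [Module.Finite ℚ_[p] M]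
    (ρ : GaloisRep F ℚ_[p] M) (h2 : Module.finrank ℚ_[p] M = 2)
    (hρ : GaloisRep.IsDeRham (bdRPeriodRingData (F := F) (p := p) hp) ρ)
    (hdet : ∀ σ : absoluteGaloisGroup F, LinearMap.det (ρ σ : M →ₗ[ℚ_[p]] M) =
      (((GaloisRep.cyclotomicCharacter F p σ : ℤ_[p]ˣ) : ℤ_[p]) : ℚ_[p])) :
    Module.finrank F ((bdRPeriodRingData (F := F) (p := p) hp).filD ρ 0) = 1 :=
  (PeriodRingData.FilZeroLine.nonempty_filZeroLine_iff _ _).1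
    (nonempty_filZeroLine_of_isDeRham_of_det hp ρ h2 hρ hdet)

/-! ## §4 Elliptic curves: the Néron de Rham datum from de Rham-ness of `V_pE` -/

open Literature.NumberTheory.EllipticCurves WeierstrassCurve

omit [ValuativeRel F] [TopologicalSpace F] [IsNonarchimedeanLocalField F] [Fact (¬ IsUnit (p : integerC F))]
  [IsAdicComplete (Ideal.span {(p : integerC F)}) (integerC F)] in
/-- **`det ρ_{E,p} = χ_p` on `V_pW` for an elliptic curve over the `p`-adic field `F`** (the tree's
`det_galoisRepTate_eq_cyclotomicCharacter_holds` on `T_pW`, Weil pairing PROVED, base-changed to `ℚ_p`).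
[cite: SilvermanAEC2009, Prop. III.8.1 and Prop. III.8.3] -/
theorem det_rationalTateRep_eq_cyclotomicCharacter (W : WeierstrassCurve F) [W.IsElliptic]
    (σ : absoluteGaloisGroup F) :
    LinearMap.det (rationalTateRep W p σ : W.rationalTateModule p →ₗ[ℚ_[p]] W.rationalTateModule p) =
      (((GaloisRep.cyclotomicCharacter F p σ : ℤ_[p]ˣ) : ℤ_[p]) : ℚ_[p]) := by
  have hpF : (p : F) ≠ 0 := Nat.cast_ne_zero.mpr (Fact.out : p.Prime).ne_zero
  haveI := module_free_tateModule_holds W p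
  haveI := module_finite_tateModule_holds W p
  change LinearMap.det ((W.galoisRepTate p σ).baseChange ℚ_[p]) = _
  rw [LinearMap.det_baseChange, det_galoisRepTate_eq_cyclotomicCharacter_holds W p hpF σ]
  rfl

/-- **The Néron de Rham datum exists once `V_pW` is de Rham** (`W` an elliptic curve over the `p`-adic field `F`):
`IsDeRham (rationalTateRep W p) → Nonempty (NeronDeRhamDatum hp W)`, i.e. `dim_F D⁰_dR(V_pW) = 1` — Kato's
Ex. 1.3.5 « `Lie(A) = D_dR(V_pA)/D⁰_dR(V_pA)` » for elliptic curves, from de Rham-ness and `det V_pW = ℚ_p(1)` alone.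
[cite: Kato1993LNM1553, Ch. II Ex. 1.3.5] [cite: SilvermanAEC2009, Prop. III.8.1 and Prop. III.8.3] -/
theorem nonempty_neronDeRhamDatum_of_isDeRham [Algebra ℚ_[p] F] (W : WeierstrassCurve F) [W.IsElliptic]
    (hρ : GaloisRep.IsDeRham (bdRPeriodRingData (F := F) (p := p) hp) (rationalTateRep W p)) :
    Nonempty (NeronDeRhamDatum hp W) := by
  have hpF : (p : F) ≠ 0 := Nat.cast_ne_zero.mpr (Fact.out : p.Prime).ne_zero
  haveI : Module.Finite ℚ_[p] (W.rationalTateModule p) := module_finite_rationalTateModule_holds W p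
  exact nonempty_filZeroLine_of_isDeRham_of_det hp (rationalTateRep W p)
    (finrank_rationalTateModule_eq_two_holds W p hpF) hρ (det_rationalTateRep_eq_cyclotomicCharacter W)

/-- The dimension form: **`dim_F D⁰_dR(V_pW) = 1` once `V_pW` is de Rham**. [cite: Kato1993LNM1553, Ch. II Ex. 1.3.5] -/
theorem finrank_filD_zero_rationalTateRep_eq_one_of_isDeRham [Algebra ℚ_[p] F] (W : WeierstrassCurve F)
    [W.IsElliptic] (hρ : GaloisRep.IsDeRham (bdRPeriodRingData (F := F) (p := p) hp) (rationalTateRep W p)) :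
    Module.finrank F ((bdRPeriodRingData (F := F) (p := p) hp).filD (rationalTateRep W p) 0) = 1 :=
  (PeriodRingData.FilZeroLine.nonempty_filZeroLine_iff _ _).1 (nonempty_neronDeRhamDatum_of_isDeRham hp W hρ)

/-- **The named fact `nonempty_neronDeRhamDatum` REDUCED to de Rham-ness of `V_pW`** (for every `p`-adic field and
every elliptic curve over it): the Néron-line half of Kato's Ex. 1.3.5 is a consequence of its de Rham half.
[cite: Kato1993LNM1553, Ch. II Ex. 1.3.5] -/
theorem nonempty_neronDeRhamDatum_of_forall_isDeRham
    (hDR : ∀ {F : Type} [Field F] [ValuativeRel F] [TopologicalSpace F] [IsNonarchimedeanLocalField F]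
      [CharZero F] {p : ℕ} [Fact p.Prime] [Fact (¬ IsUnit (p : integerC F))]
      [IsAdicComplete (Ideal.span {(p : integerC F)}) (integerC F)] [Algebra ℚ_[p] F]
      (hp : valuation F p < 1) (W : WeierstrassCurve F) [W.IsElliptic],
      GaloisRep.IsDeRham (bdRPeriodRingData (F := F) (p := p) hp) (rationalTateRep W p)) :
    nonempty_neronDeRhamDatum :=
  fun hp W _ => nonempty_neronDeRhamDatum_of_isDeRham hp W (hDR hp W)

omit [ValuativeRel F] [TopologicalSpace F] [IsNonarchimedeanLocalField F] [CharZero F]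
  [Fact (¬ IsUnit (p : integerC F))] [IsAdicComplete (Ideal.span {(p : integerC F)}) (integerC F)] in
/-- **`det = χ_p` for the restricted representation `V_pW|_{Γ_F}`** of a curve `W/K₀`, `K₀ ⊆ F`
(`det ρ_{W,p}(res σ) = χ_{K₀,p}(res σ) = χ_{F,p}(σ)`, `cyclotomicCharacter_absGaloisRestrict`).
[cite: SilvermanAEC2009, Prop. III.8.1 and Prop. III.8.3] -/
theorem det_restrictedRationalTateRep_eq_cyclotomicCharacter {K₀ : Type} [Field K₀] [CharZero K₀]
    (W : WeierstrassCurve K₀) [W.IsElliptic] [Algebra K₀ F] (σ : absoluteGaloisGroup F) :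
    LinearMap.det (restrictedRationalTateRep W F p σ : W.rationalTateModule p →ₗ[ℚ_[p]] W.rationalTateModule p) =
      (((GaloisRep.cyclotomicCharacter F p σ : ℤ_[p]ˣ) : ℤ_[p]) : ℚ_[p]) := by
  have hpK : (p : K₀) ≠ 0 := Nat.cast_ne_zero.mpr (Fact.out : p.Prime).ne_zero
  haveI : NeZero (p : K₀) := ⟨hpK⟩
  haveI := module_free_tateModule_holds W p
  haveI := module_finite_tateModule_holds W p
  rw [← cyclotomicCharacter_absGaloisRestrict K₀ F p σ]
  change LinearMap.det ((W.galoisRepTate p (absGaloisRestrict K₀ F σ)).baseChange ℚ_[p]) = _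
  rw [LinearMap.det_baseChange, det_galoisRepTate_eq_cyclotomicCharacter_holds W p hpK]
  rfl

/-- **A generator of `D⁰_dR(V_pW|_{Γ_F})` exists for every curve `W/K₀` and every `p`-adic field `F ⊇ K₀`**, GRANTED
the cite-only de Rham fact `isDeRham_restrictedRationalTateRep` VERBATIM (Fontaine 1982: `V_pE` is de Rham) — the
line data `LocalNeronLine` of the BSD consumers (`K₀ = ℚ`). [cite: Kato1993LNM1553, Ch. II Ex. 1.3.5]
[cite: Fontaine1982FormesDifferentielles] [cite: SilvermanAEC2009, Prop. III.8.1 and Prop. III.8.3] -/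
theorem nonempty_filZeroLine_restrictedRationalTateRep_of_isDeRham (hDR : isDeRham_restrictedRationalTateRep)
    {K₀ : Type} [Field K₀] [CharZero K₀] (W : WeierstrassCurve K₀) [W.IsElliptic] [Algebra K₀ F]
    [Algebra ℚ_[p] F] :
    Nonempty ((bdRPeriodRingData (F := F) (p := p) hp).FilZeroLine (restrictedRationalTateRep W F p)) := by
  have hpK : (p : K₀) ≠ 0 := Nat.cast_ne_zero.mpr (Fact.out : p.Prime).ne_zero
  haveI : Module.Finite ℚ_[p] (W.rationalTateModule p) := module_finite_rationalTateModule_holds W p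
  exact nonempty_filZeroLine_of_isDeRham_of_det hp (restrictedRationalTateRep W F p)
    (finrank_rationalTateModule_eq_two_holds W p hpK) (hDR W hp)
    (det_restrictedRationalTateRep_eq_cyclotomicCharacter W)

/-! ## §5 The named fact `nonempty_neronDeRhamDatum` from the cite-only de Rham fact VERBATIM

Appended 2026-08-28 (same seat): with the inner-twist invariance of admissibility (file
`GaloisRepresentations/PeriodRingDataInnerTwist`, `GaloisRep.isDeRham_restrict_absGaloisRestrict_self_iff`), the de Rham
input in the shape the tree states it — `isDeRham_restrictedRationalTateRep` (a curve `W/K₀` and a `p`-adic field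
`F ⊇ K₀`; at `K₀ = F` the representation is the SELF-restriction `V_pW|_{Γ_F} ∘ absGaloisRestrict F F`, an inner twist
of `V_pW`) — yields de Rham-ness of `rationalTateRep W p` itself, hence the named fact. -/

/-- **`V_pW` is de Rham once its self-restriction is** (`W/F`; the cite-only fact `isDeRham_restrictedRationalTateRep` at
`K₀ = F` speaks about `V_pW ∘ absGaloisRestrict F F`, an inner twist of `V_pW`).
[cite: FontaineAsterisque223III, Exp. III §1.5] [cite: Kato1993LNM1553, Ch. II Ex. 1.3.5] -/
theorem isDeRham_rationalTateRep_of_isDeRham_restricted [Algebra ℚ_[p] F]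
    (hDR : isDeRham_restrictedRationalTateRep) (W : WeierstrassCurve F) [W.IsElliptic] :
    GaloisRep.IsDeRham (bdRPeriodRingData (F := F) (p := p) hp) (rationalTateRep W p) :=
  (GaloisRep.isDeRham_restrict_absGaloisRestrict_self_iff (bdRPeriodRingData (F := F) (p := p) hp)
    (rationalTateRep W p)).1 (hDR W hp)

/-- **The named fact `nonempty_neronDeRhamDatum` ⟸ the named fact `isDeRham_restrictedRationalTateRep`** (both cite-only
in the tree; Kato, LNM 1553, Ch. II Ex. 1.3.5: the Néron-line half « `Lie(A) = D_dR(V_pA)/D⁰_dR(V_pA)` » follows from the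
de Rham half « `V_pA` is a de Rham representation » and `det V_pE = ℚ_p(1)`). Consumers holding
`(h : nonempty_neronDeRhamDatum)` may pass `nonempty_neronDeRhamDatum_of_isDeRham_restricted hDR` instead.
[cite: Kato1993LNM1553, Ch. II Ex. 1.3.5] [cite: Fontaine1982FormesDifferentielles] -/
theorem nonempty_neronDeRhamDatum_of_isDeRham_restricted (hDR : isDeRham_restrictedRationalTateRep) :
    nonempty_neronDeRhamDatum :=
  fun hp W _ => nonempty_neronDeRhamDatum_of_isDeRham hp W (isDeRham_rationalTateRep_of_isDeRham_restricted hp hDR W)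

end Literature.NumberTheory.PAdicHodge

end
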